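import Literature.RingTheory.MvPolynomial.LeadingExponents
import Literature.RingTheory.HilbertSamuel.PolynomialRing
import Literature.Order.WellQuasiOrder.UpperSets
import Mathlib.NumberTheory.Bernoulli
import Mathlib.Data.Fin.Tuple.NatAntidiagonal
import Mathlib.Data.Finsupp.MonomialOrder
import Mathlib.RingTheory.Polynomial.Pochhammer
import HarnessLib

/-!
# Existence of the Hilbert polynomial of a homogeneous ideal of `K[X₀, …, X_{m-1}]`

Topic: `Literature/RingTheory/MvPolynomial`. For a homogeneous ideal `I` of the polynomial ring
`S = K[X_0, …, X_{m-1}]` over a field, the function `t ↦ dim_K I_t` (and hence the Hilbert function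
`H(I; t) = dim_K S_t - dim_K I_t`) agrees with a polynomial for all large `t` (Hilbert 1890; e.g.
Hartshorne, *Algebraic Geometry*, I.7.5; Bruns–Herzog 4.1.3). The proof given here is Macaulay's:
`dim_K I_t` is the number of leading exponents of `I` of degree `t`
(`finrank_idealDegree_eq_card`, `LeadingExponents.lean`), the leading exponents form an UPPER SET
`E ⊆ ℕ^m`, and for every upper set the number of its points of degree `t` is eventually polynomial
in `t` — by induction on `m`, slicing along the first coordinate: the slices `E_c = {b | (c, b) ∈ E}`
increase with `c` and stabilise (monomial ideals satisfy the ascending chain condition: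
`Maclagan.wellFoundedLT_upperSet`, `Literature/Order/WellQuasiOrder/UpperSets.lean`), so that
`#E(t) = Σ_{c < c₀} #E_c(t - c) + Σ_{s ≤ t - c₀} #E_{c₀}(s)`, and sums `Σ_{s ≤ T} p(s)` of polynomial
values are polynomial in `T` (Faulhaber's formula, Mathlib `sum_range_pow`).

* `exists_polynomial_sum_range_eval` — `Σ_{s < N} p(s)` is a polynomial in `N` (Faulhaber);
* `exists_polynomial_card_antidiagonalTuple_filter` — for an upper set `E ⊆ ℕ^m`,
  `t ↦ #{a ∈ E : |a| = t}` is eventually a polynomial;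
* `exists_polynomial_card_finsuppAntidiag_filter` — the same for upper sets of `Fin m →₀ ℕ`;
* **`exists_hilbertPolynomial_idealDegree`** — for a homogeneous ideal `I ⊆ K[X_0, …, X_{m-1}]`
  there are `p ∈ ℚ[T]` and `t₀` with `dim_K I_t = p(t)` for all `t ≥ t₀`;
* `finrank_homogeneousSubmodule_eq_eval` — `dim_K S_t = binom(t+m-1, m-1)` is the value at `t` of
  the polynomial `(1/(m-1)!) · (T+1)(T+2)⋯(T+m-1)` (for `m ≥ 1`), monic up to the factor
  `1/(m-1)!`, of degree `m - 1`;
* **`exists_hilbertPolynomial`** — `H(I; t) = dim S_t - dim I_t` is eventually a polynomial.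

No new definitions ("eventually polynomial" is spelled out as `∃ p t₀, ∀ t ≥ t₀, … = p.eval ↑t`).

## References

* R. Hartshorne, *Algebraic Geometry*, GTM 52 (1977), Ch. I, Thm. 7.5. [Hartshorne1977]
* W. Bruns, J. Herzog, *Cohen–Macaulay rings* (1998), Thm. 4.1.3 and §4.2 (Macaulay).
  [BrunsHerzog1998]
-/

noncomputable section

open Module Finset Polynomial

attribute [local instance] MvPolynomial.gradedAlgebra

namespace Literature.RingTheory.MvPolynomial

/-! ## Sums of polynomial values are polynomial (Faulhaber) -/

/-- `Σ_{s < N} s^j` is a polynomial in `N` (Faulhaber's formula, Mathlib `sum_range_pow`).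
[folklore] -/
theorem exists_polynomial_sum_range_pow (j : ℕ) :
    ∃ F : ℚ[X], ∀ N : ℕ, ∑ s ∈ range N, ((s : ℚ)) ^ j = F.eval (N : ℚ) := by
  refine ⟨∑ i ∈ range (j + 1),
    Polynomial.C (bernoulli i * ((j + 1).choose i) / (j + 1)) * X ^ (j + 1 - i), fun N => ?_⟩
  rw [sum_range_pow, eval_finsetSum]
  refine sum_congr rfl fun i _ => ?_
  simp only [eval_mul, eval_C, eval_pow, eval_X]
  ring

/-- `Σ_{s < N} p(s)` is a polynomial in `N`, for every polynomial `p`. [folklore] -/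
theorem exists_polynomial_sum_range_eval (p : ℚ[X]) :
    ∃ F : ℚ[X], ∀ N : ℕ, ∑ s ∈ range N, p.eval (s : ℚ) = F.eval (N : ℚ) := by
  choose F hF using exists_polynomial_sum_range_pow
  refine ⟨∑ j ∈ range (p.natDegree + 1), Polynomial.C (p.coeff j) * F j, fun N => ?_⟩
  simp_rw [eval_eq_sum_range (p := p), eval_finsetSum, eval_mul, eval_C, ← hF, mul_sum]
  exact sum_comm

/-- Partial sums of an eventually polynomial function are eventually polynomial. [folklore] -/
theorem exists_polynomial_partialSum {g : ℕ → ℚ} {p : ℚ[X]} {s₀ : ℕ}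
    (hg : ∀ s, s₀ ≤ s → g s = p.eval (s : ℚ)) :
    ∃ G : ℚ[X], ∀ T, s₀ ≤ T → ∑ s ∈ range (T + 1), g s = G.eval (T : ℚ) := by
  obtain ⟨F, hF⟩ := exists_polynomial_sum_range_eval p
  refine ⟨Polynomial.C ((∑ s ∈ range s₀, g s) - F.eval (s₀ : ℚ)) + F.comp (X + 1), fun T hT => ?_⟩
  have hsplit := (sum_range_add_sum_Ico g (show s₀ ≤ T + 1 by omega)).symm
  rw [hsplit]
  have hIco : ∑ k ∈ Ico s₀ (T + 1), g k = ∑ k ∈ Ico s₀ (T + 1), p.eval (k : ℚ) :=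
    sum_congr rfl fun k hk => hg k (mem_Ico.mp hk).1
  have hIco' : ∑ k ∈ Ico s₀ (T + 1), p.eval (k : ℚ) =
      F.eval ((T + 1 : ℕ) : ℚ) - F.eval (s₀ : ℚ) := by
    rw [← hF, ← hF, eq_sub_iff_add_eq, add_comm, sum_range_add_sum_Ico _ (by omega)]
  rw [hIco, hIco', eval_add, eval_C, eval_comp, eval_add, eval_X, eval_one, Nat.cast_add,
    Nat.cast_one]
  ring

/-! ## Counting points of an upper set of `ℕ^m` degree by degree -/

/-- Slicing the count along the first coordinate:
`#{a ∈ E : |a| = t} = Σ_{c ≤ t} #{b : |b| = t - c, (c, b) ∈ E}`. [folklore] -/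
theorem card_antidiagonalTuple_succ_filter_eq_sum (n t : ℕ) (E : Set (Fin (n + 1) → ℕ))
    [DecidablePred (· ∈ E)] :
    ((Finset.Nat.antidiagonalTuple (n + 1) t).filter (· ∈ E)).card =
      ∑ c ∈ range (t + 1),
        ((Finset.Nat.antidiagonalTuple n (t - c)).filter (fun b => Fin.cons c b ∈ E)).card := by
  classical
  rw [card_eq_sum_card_fiberwise (f := fun a : Fin (n + 1) → ℕ => a 0)
    (s := (Finset.Nat.antidiagonalTuple (n + 1) t).filter (· ∈ E)) (t := range (t + 1)) ?maps]
  case maps =>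
    intro a ha
    rw [mem_coe, mem_filter, Finset.Nat.mem_antidiagonalTuple] at ha
    rw [mem_coe, mem_range, Nat.lt_succ_iff, ← ha.1]
    exact Finset.single_le_sum (f := a) (fun _ _ => Nat.zero_le _) (mem_univ 0)
  refine sum_congr rfl fun c hc => ?_
  apply card_bij' (fun (a : Fin (n + 1) → ℕ) _ => Fin.tail a) (fun (b : Fin n → ℕ) _ => Fin.cons c b)
  · intro a ha
    rw [mem_filter, mem_filter, Finset.Nat.mem_antidiagonalTuple] at ha
    obtain ⟨⟨hsum, haE⟩, h0⟩ := ha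
    rw [mem_filter, Finset.Nat.mem_antidiagonalTuple]
    rw [Fin.sum_univ_succ, h0] at hsum
    refine ⟨?_, ?_⟩
    · show ∑ i : Fin n, a i.succ = t - c
      omega
    · rw [← h0, Fin.cons_self_tail]
      exact haE
  · intro b hb
    rw [mem_filter, Finset.Nat.mem_antidiagonalTuple] at hb
    obtain ⟨hsum, hbE⟩ := hb
    have hct : c ≤ t := Nat.lt_succ_iff.mp (mem_range.mp hc)
    rw [mem_filter, mem_filter, Finset.Nat.mem_antidiagonalTuple]
    refine ⟨⟨?_, hbE⟩, rfl⟩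
    rw [Fin.sum_univ_succ]
    show c + ∑ i : Fin n, b i = t
    omega
  · intro a ha
    rw [mem_filter] at ha
    conv_rhs => rw [← Fin.cons_self_tail a]
    rw [ha.2]
  · intro b _
    rfl

/-- **For an upper set `E ⊆ ℕ^m`, the number of points of `E` of degree `t` is a polynomial in
`t` for large `t`** (the Hilbert function of a monomial ideal is eventually polynomial; induction on
`m` by slicing along the first coordinate, the slices stabilising by the ascending chain condition
for monomial ideals). [folklore] -/
theorem exists_polynomial_card_antidiagonalTuple_filter :
    ∀ (n : ℕ) (E : Set (Fin n → ℕ)) [DecidablePred (· ∈ E)], IsUpperSet E →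
      ∃ (p : ℚ[X]) (t₀ : ℕ), ∀ t, t₀ ≤ t →
        ((((Finset.Nat.antidiagonalTuple n t).filter (· ∈ E)).card : ℕ) : ℚ) = p.eval (t : ℚ) := by
  intro n
  induction n with
  | zero =>
    intro E _ _
    refine ⟨0, 1, fun t ht => ?_⟩
    obtain ⟨t, rfl⟩ : ∃ s, t = s + 1 := ⟨t - 1, by omega⟩
    simp [Finset.Nat.antidiagonalTuple_zero_succ]
  | succ n ih =>
    intro E _ hE
    classical
    -- the slices `E_c = {b | (c, b) ∈ E}`, upper sets increasing with `c`
    have hup : ∀ c : ℕ, IsUpperSet {b : Fin n → ℕ | (Fin.cons c b : Fin (n + 1) → ℕ) ∈ E} := by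
      intro c b b' hbb' hb
      simp only [Set.mem_setOf_eq] at hb ⊢
      exact hE (Fin.cons_le_cons.mpr ⟨le_rfl, hbb'⟩) hb
    let Es : ℕ → UpperSet (Fin n → ℕ) := fun c =>
      ⟨{b : Fin n → ℕ | (Fin.cons c b : Fin (n + 1) → ℕ) ∈ E}, hup c⟩
    have hEs_mem : ∀ c b, b ∈ Es c ↔ (Fin.cons c b : Fin (n + 1) → ℕ) ∈ E := fun c b => Iff.rfl
    have hanti : Antitone Es := by
      intro c c' hcc'
      rw [← UpperSet.coe_subset_coe]
      intro b hb
      rw [SetLike.mem_coe, hEs_mem] at hb ⊢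
      exact hE (Fin.cons_le_cons.mpr ⟨hcc', le_rfl⟩) hb
    haveI := Literature.Order.WellQuasiOrder.Maclagan.wellFoundedLT_upperSet (n := n)
    obtain ⟨c₀, hc₀⟩ := WellFoundedLT.antitone_chain_condition hanti
    -- eventual polynomials for the slices `E_c`, `c ≤ c₀`
    have hslice : ∀ c, ∃ (p : ℚ[X]) (t₀ : ℕ), ∀ t, t₀ ≤ t →
        ((((Finset.Nat.antidiagonalTuple n t).filter (fun b => Fin.cons c b ∈ E)).card : ℕ) : ℚ) =
          p.eval (t : ℚ) := by
      intro c
      obtain ⟨p, t₀, hp⟩ := ih (Es c : Set (Fin n → ℕ)) (Es c).upper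
      refine ⟨p, t₀, fun t ht => ?_⟩
      rw [← hp t ht]
      congr 2
      exact filter_congr fun b _ => (hEs_mem c b).symm
    choose p t₁ hp using hslice
    -- partial sums of the stable slice
    obtain ⟨G, hG⟩ := exists_polynomial_partialSum (hp c₀)
    refine ⟨(∑ c ∈ range c₀, (p c).comp (X - Polynomial.C (c : ℚ))) + G.comp (X - Polynomial.C (c₀ : ℚ)),
      c₀ + ((range (c₀ + 1)).sup t₁), fun t ht => ?_⟩
    have hsup : ∀ c, c ≤ c₀ → t₁ c ≤ (range (c₀ + 1)).sup t₁ := fun c hc =>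
      Finset.le_sup (f := t₁) (mem_range.mpr (Nat.lt_succ_of_le hc))
    rw [card_antidiagonalTuple_succ_filter_eq_sum, ← sum_range_add_sum_Ico _ (show c₀ ≤ t + 1 by omega)]
    push_cast
    rw [eval_add, eval_finsetSum]
    congr 1
    · refine sum_congr rfl fun c hc => ?_
      have hc' : c < c₀ := mem_range.mp hc
      have h1 : t₁ c ≤ t - c := by have := hsup c hc'.le; omega
      rw [hp c (t - c) h1, eval_comp, eval_sub, eval_X, eval_C, Nat.cast_sub (by omega)]
    · -- the stable range: reindex `c ↦ t - c`
      have hstab : ∀ c ∈ Ico c₀ (t + 1),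
          ((((Finset.Nat.antidiagonalTuple n (t - c)).filter (fun b => Fin.cons c b ∈ E)).card : ℕ) : ℚ) =
            ((((Finset.Nat.antidiagonalTuple n (t - c)).filter
              (fun b => Fin.cons c₀ b ∈ E)).card : ℕ) : ℚ) := by
        intro c hc
        have hc' : c₀ ≤ c := (mem_Ico.mp hc).1
        congr 2
        refine filter_congr fun b _ => ?_
        rw [← hEs_mem, ← hEs_mem, ← hc₀ c hc']
      rw [sum_congr rfl hstab, sum_Ico_eq_sum_range]
      have hlen : t + 1 - c₀ = (t - c₀) + 1 := by omega
      rw [hlen, ← sum_range_reflect]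
      have hrefl : ∀ j ∈ range (t - c₀ + 1),
          ((((Finset.Nat.antidiagonalTuple n (t - (c₀ + (t - c₀ + 1 - 1 - j)))).filter
            (fun b => Fin.cons c₀ b ∈ E)).card : ℕ) : ℚ) =
          ((((Finset.Nat.antidiagonalTuple n j).filter (fun b => Fin.cons c₀ b ∈ E)).card : ℕ) : ℚ) := by
        intro j hj
        have hj' := mem_range.mp hj
        congr 4
        omega
      rw [sum_congr rfl hrefl, hG (t - c₀) (by have := hsup c₀ le_rfl; omega), eval_comp, eval_sub,
        eval_X, eval_C, Nat.cast_sub (by omega)]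

/-- The same count for upper sets of finitely supported functions `Fin m →₀ ℕ` (the exponent
vectors of `MvPolynomial (Fin m) K`). [folklore] -/
theorem exists_polynomial_card_finsuppAntidiag_filter {m : ℕ} (E : Set (Fin m →₀ ℕ))
    [DecidablePred (· ∈ E)] (hE : IsUpperSet E) :
    ∃ (p : ℚ[X]) (t₀ : ℕ), ∀ t, t₀ ≤ t →
      (((((univ : Finset (Fin m)).finsuppAntidiag t).filter (· ∈ E)).card : ℕ) : ℚ) = p.eval (t : ℚ) := by
  classical
  let E' : Set (Fin m → ℕ) := {a | Finsupp.equivFunOnFinite.symm a ∈ E}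
  have hE' : IsUpperSet E' := by
    intro a b hab ha
    refine hE ?_ ha
    intro i
    simpa using hab i
  obtain ⟨p, t₀, hp⟩ := exists_polynomial_card_antidiagonalTuple_filter m E' hE'
  refine ⟨p, t₀, fun t ht => ?_⟩
  rw [← hp t ht]
  congr 1
  apply card_bij' (fun (a : Fin m →₀ ℕ) _ => (⇑a : Fin m → ℕ))
    (fun (a : Fin m → ℕ) _ => Finsupp.equivFunOnFinite.symm a)
  · intro a ha
    simp only [mem_filter, mem_finsuppAntidiag, Finset.Nat.mem_antidiagonalTuple] at ha ⊢
    refine ⟨ha.1.1, ?_⟩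
    change Finsupp.equivFunOnFinite.symm ⇑a ∈ E
    simpa using ha.2
  · intro a ha
    simp only [mem_filter, mem_finsuppAntidiag, Finset.Nat.mem_antidiagonalTuple] at ha ⊢
    exact ⟨⟨by simpa using ha.1, subset_univ _⟩, ha.2⟩
  · intro a _; simp
  · intro a _; simp

/-! ## The Hilbert polynomial -/

/-- **Existence of the Hilbert polynomial, `I_t` form** (Hilbert; Hartshorne I.7.5): for a
homogeneous ideal `I ⊆ K[X_0, …, X_{m-1}]` over a field there are `p ∈ ℚ[T]` and `t₀` such that
`dim_K I_t = p(t)` for all `t ≥ t₀`. Proof: Macaulay's count `dim_K I_t = #{leading exponents of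
degree t}` (`finrank_idealDegree_eq_card`, lexicographic order) and the previous theorem.
[cite: Hartshorne1977, Ch. I Thm. 7.5] -/
theorem exists_hilbertPolynomial_idealDegree {K : Type*} [Field K] {m : ℕ}
    (I : Ideal (MvPolynomial (Fin m) K)) (hI : I.IsHomogeneous (MvPolynomial.homogeneousSubmodule (Fin m) K)) :
    ∃ (p : ℚ[X]) (t₀ : ℕ), ∀ t, t₀ ≤ t → (finrank K (idealDegree I t) : ℚ) = p.eval (t : ℚ) := by
  classical
  obtain ⟨p, t₀, hp⟩ := exists_polynomial_card_finsuppAntidiag_filter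
    (leadingExponents MonomialOrder.lex I) (isUpperSet_leadingExponents MonomialOrder.lex I)
  refine ⟨p, t₀, fun t ht => ?_⟩
  rw [← hp t ht, finrank_idealDegree_eq_card MonomialOrder.lex I
    (fun f hf d => MvPolynomial.homogeneousComponent_mem_of_mem hI hf d) t]

/-- **`dim_K S_t` as a polynomial in `t`**: for `m ≥ 1` variables,
`dim_K S_t = binom(t + m - 1, m - 1) = (t+1)(t+2)⋯(t+m-1)/(m-1)!`, the value at `t` of
`(1/(m-1)!) · ascPochhammer(m-1)(T + 1)`. [folklore] -/
theorem finrank_homogeneousSubmodule_eq_eval {K : Type*} [Field K] (m t : ℕ) (hm : 1 ≤ m) :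
    (finrank K (MvPolynomial.homogeneousSubmodule (Fin m) K t) : ℚ) =
      (Polynomial.C ((((m - 1).factorial : ℕ) : ℚ)⁻¹) *
        (ascPochhammer ℚ (m - 1)).comp (X + 1)).eval (t : ℚ) := by
  rw [Literature.RingTheory.HilbertSamuel.finrank_homogeneousSubmodule_fin]
  obtain ⟨k, rfl⟩ : ∃ k, m = k + 1 := ⟨m - 1, by omega⟩
  simp only [Nat.add_sub_cancel, eval_mul, eval_C, eval_comp, eval_add, eval_X, eval_one]
  have h1 : (t + (k + 1) - 1).choose t = (t + k).choose k := by
    rw [show t + (k + 1) - 1 = t + k by omega, Nat.choose_symm_add]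
  have h2 : ((t + 1).ascFactorial k : ℚ) = (k.factorial : ℚ) * ((t + k).choose k : ℚ) := by
    exact_mod_cast Nat.ascFactorial_eq_factorial_mul_choose t k
  have h3 : ((t + 1).ascFactorial k : ℚ) = (ascPochhammer ℚ k).eval ((t : ℚ) + 1) := by
    rw [Nat.cast_ascFactorial]; push_cast; rfl
  have hk : (k.factorial : ℚ) ≠ 0 := by exact_mod_cast k.factorial_ne_zero
  rw [h1, ← h3, h2, ← mul_assoc, inv_mul_cancel₀ hk, one_mul]

/-- The polynomial giving `dim_K S_t` has degree `m - 1` and leading coefficient `1/(m-1)!`.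
[folklore] -/
theorem natDegree_leadingCoeff_hilbertPolynomial_top (m : ℕ) :
    (Polynomial.C ((((m - 1).factorial : ℕ) : ℚ)⁻¹) *
        (ascPochhammer ℚ (m - 1)).comp (X + 1)).natDegree = m - 1 ∧
    (Polynomial.C ((((m - 1).factorial : ℕ) : ℚ)⁻¹) *
        (ascPochhammer ℚ (m - 1)).comp (X + 1)).leadingCoeff = ((((m - 1).factorial : ℕ) : ℚ)⁻¹) := by
  have hc : ((((m - 1).factorial : ℕ) : ℚ)⁻¹) ≠ 0 :=
    inv_ne_zero (by exact_mod_cast (m - 1).factorial_ne_zero)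
  have hX1 : (X + 1 : ℚ[X]) = X + Polynomial.C 1 := by rw [map_one]
  have hdeg1 : (X + 1 : ℚ[X]).natDegree = 1 := by rw [hX1, natDegree_X_add_C]
  have hmonic : ((ascPochhammer ℚ (m - 1)).comp (X + 1)).Monic :=
    (monic_ascPochhammer ℚ (m - 1)).comp (by rw [hX1]; exact monic_X_add_C 1)
      (by rw [hdeg1]; exact one_ne_zero)
  have hdeg : ((ascPochhammer ℚ (m - 1)).comp (X + 1)).natDegree = m - 1 := by
    rw [natDegree_comp, hdeg1, mul_one, ascPochhammer_natDegree]
  constructor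
  · rw [natDegree_C_mul hc, hdeg]
  · rw [leadingCoeff_mul, leadingCoeff_C, hmonic.leadingCoeff, mul_one]

/-- **Existence of the Hilbert polynomial** (Hilbert; Hartshorne I.7.5): for a homogeneous ideal
`I ⊆ S = K[X_0, …, X_{m-1}]` the Hilbert function `H(I; t) = dim_K S_t - dim_K I_t` agrees with a
polynomial `P_I ∈ ℚ[T]` for all large `t`. [cite: Hartshorne1977, Ch. I Thm. 7.5] -/
theorem exists_hilbertPolynomial {K : Type*} [Field K] {m : ℕ}
    (I : Ideal (MvPolynomial (Fin m) K)) (hI : I.IsHomogeneous (MvPolynomial.homogeneousSubmodule (Fin m) K)) :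
    ∃ (p : ℚ[X]) (t₀ : ℕ), ∀ t, t₀ ≤ t →
      (((finrank K (MvPolynomial.homogeneousSubmodule (Fin m) K t) - finrank K (idealDegree I t) : ℕ)) : ℚ) =
        p.eval (t : ℚ) := by
  classical
  obtain ⟨p, t₀, hp⟩ := exists_hilbertPolynomial_idealDegree I hI
  obtain ⟨q, t₁, hq⟩ := exists_hilbertPolynomial_idealDegree (⊤ : Ideal (MvPolynomial (Fin m) K))
    (Ideal.IsHomogeneous.top _)
  refine ⟨q - p, max t₀ t₁, fun t ht => ?_⟩
  have hle : finrank K (idealDegree I t) ≤ finrank K (MvPolynomial.homogeneousSubmodule (Fin m) K t) := by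
    haveI : Module.Finite K (MvPolynomial.homogeneousSubmodule (Fin m) K t) :=
      Module.Finite.iff_fg.mpr (MvPolynomial.homogeneousSubmodule_fg (Fin m) K t)
    exact Submodule.finrank_mono (inf_le_right : idealDegree I t ≤ _)
  have htop : idealDegree (⊤ : Ideal (MvPolynomial (Fin m) K)) t = MvPolynomial.homogeneousSubmodule (Fin m) K t := by
    ext f; simp [mem_idealDegree, MvPolynomial.mem_homogeneousSubmodule]
  rw [Nat.cast_sub hle, eval_sub, ← hp t (le_of_max_le_left ht), ← hq t (le_of_max_le_right ht), htop]

end Literature.RingTheory.MvPolynomial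

end
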